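import Summits.AtomisticToContinuum.BoseEinsteinCondensation.Theorems.BECCellInformationOneBodyEntropyBoundDirichletFloor
import Summits.AtomisticToContinuum.BoseEinsteinCondensation.Theorems.BECCellInformationOneBodyEntropyBoundFVBridge
import HarnessLib

/-!
# First variation of the Rayleigh quotient at a near-minimiser (`stub_firstVariation`)

Crux `stmt-AtomisticToContinuum-13034` (`RigidMomentumBound`, route `BECTangentRigidity`), line
`registered`, stub `stub_firstVariation` (brick F1). For a measurable pair potential `v` (hard cores
allowed), an admissible `Φ : TrialState N L` of finite energy `E = ⟨Φ,HΦ⟩ ≤ E₀(N,L) + δ` (`δ > 0`)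
and a real `C¹` multiplier `G` on configuration space with `|G| ≤ 1` and `∑_{i,k} |∂_{i,k}G|² ≤ D²`,
`|∫ G e_Φ + ∫ ∑_{i,k} ∂_{i,k}G · Re(Φ̄ ∂_{i,k}Φ) − E ∫ G|Φ|²| ≤ √δ (3E + 2D² + δ + 1) + δ`,
where `e_Φ = |∇Φ|² + ∑_{i<j} v |Φ|²` is the energy density.

Proof. For real `t` the function `(1 + tG)Φ` is `C¹` and vanishes off the box, so the DIRICHLET
BOSONIC FLOOR (`DirichletFloor.groundStateEnergy_mul_lintegral_le`, no permutation symmetry of `G`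
needed) gives `E₀ ∫ (1+tG)²|Φ|² ≤ ∫ (|∇((1+tG)Φ)|² + V |(1+tG)Φ|²)`. Both sides are quadratic
polynomials in `t` (`|∇((1+tG)Φ)|² = (1+tG)²|∇Φ|² + 2t(1+tG) ∇G·Re(Φ̄∇Φ) + t²|∇G|²|Φ|²`; the
real-integral dictionary of `…OneBodyEntropyBoundFVBridge.lean` is reused verbatim), `E₀ ≥ E − δ`,
and comparing at `t = ±√δ` with `|∫G|Φ|²| ≤ 1`, `∫G²|Φ|² ≤ 1` and the `t²`-coefficient bounded by
`2E + 2D²` (AM–GM on the cross term) yields the claim (with room to spare).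
-/

noncomputable section

namespace Summit.AtomisticToContinuum.BoseEinsteinCondensation.Theorems.RigidMomentumBound

open MeasureTheory Filter Set
open scoped ENNReal NNReal BigOperators
open Literature.MathematicalPhysics.QuantumManyBody.BoseGas
open Summit.AtomisticToContinuum.BoseEinsteinCondensation.Cruxes.OneBodyEntropyBound.Birth

namespace FirstVariationRQ

variable {n : ℕ} {L : ℝ} {v : ℝ → ℝ≥0∞}

/-- The real inner product of `ℂ` is `Re(z̄ w)`. [folklore] -/
theorem inner_eq_re_conj_mul (z w : ℂ) : inner ℝ z w = RCLike.re (starRingEnd ℂ z * w) := by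
  rw [Complex.inner, RCLike.re_to_complex, mul_comm]

/-- The cross density `∑ ∂G·⟨ψ, ∂ψ⟩` is integrable for a finite-energy state when `∑ (∂G)² ≤ D²`
(dominated by `(D²|ψ|² + |∇ψ|²)/2`). [folklore] -/
theorem integrable_cross_of_sum_sq_le {G : Config n → ℝ} (hG : ContDiff ℝ 1 G) {D : ℝ}
    (hD : ∀ X, ∑ i : Fin n, ∑ k : Fin 3,
      (fderiv ℝ G X (Pi.single i (EuclideanSpace.single k (1 : ℝ)))) ^ 2 ≤ D ^ 2)
    (Φ : TrialState n L) (hE : energy v Φ ≠ ⊤) :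
    Integrable fun X => ∑ i : Fin n, ∑ k : Fin 3,
      fderiv ℝ G X (Pi.single i (EuclideanSpace.single k (1 : ℝ))) *
        inner ℝ (Φ.ψ X) (fderiv ℝ Φ.ψ X (Pi.single i (EuclideanSpace.single k (1 : ℝ)))) := by
  refine Integrable.mono'
    (g := fun X => (D ^ 2 * ‖Φ.ψ X‖ ^ 2 + (kineticDensity Φ.ψ X).toReal) / 2) ?_
    (FirstVariation.continuous_cross hG Φ.contDiff).aestronglyMeasurable (ae_of_all _ fun X => ?_)
  · exact (((FirstVariation.integrable_normSq Φ).const_mul _).add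
      (FirstVariation.integrable_toReal_kineticDensity Φ hE)).div_const 2
  · rw [Real.norm_eq_abs]
    refine (FVCalc.abs_cross_le G Φ.ψ X).trans ?_
    gcongr
    exact hD X

/-- **Dirichlet bosonic floor for `Hψ` in real terms** (no symmetry of `H`): for a finite-energy
trial state `Φ`, a bounded real `C¹` multiplier `H` with `∇H = q∇G`, and an integrable `F` equal to
the real energy density of `Hψ`, `E₀.toReal · ∫ H²|ψ|² ≤ ∫ F`
(`DirichletFloor.groundStateEnergy_mul_lintegral_le` moved to `ℝ`).
[cite: LSSY2005, Ch. 2 (bosons: remark after (2.1))] -/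
theorem groundStateEnergy_toReal_mul_le_of_contDiff (Φ : TrialState n L) (hv : Measurable v)
    (hE : energy v Φ ≠ ⊤) {H q G : Config n → ℝ} (hH : ContDiff ℝ 1 H)
    (hq : ∀ X V, fderiv ℝ H X V = q X * fderiv ℝ G X V) {C : ℝ} (hC : ∀ X, |H X| ≤ C)
    {F : Config n → ℝ} (hF : Integrable F)
    (hFeq : ∀ X, q X ^ 2 * (∑ i : Fin n, ∑ k : Fin 3,
        (fderiv ℝ G X (Pi.single i (EuclideanSpace.single k (1 : ℝ)))) ^ 2) * ‖Φ.ψ X‖ ^ 2 +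
        H X ^ 2 * ((kineticDensity Φ.ψ X).toReal +
          (interaction v X * ((‖Φ.ψ X‖₊ : ℝ≥0∞)) ^ 2).toReal) +
        2 * (H X * q X) * (∑ i : Fin n, ∑ k : Fin 3,
          fderiv ℝ G X (Pi.single i (EuclideanSpace.single k (1 : ℝ))) *
            inner ℝ (Φ.ψ X) (fderiv ℝ Φ.ψ X (Pi.single i (EuclideanSpace.single k (1 : ℝ))))) =
        F X) :
    (groundStateEnergy v n L).toReal * ∫ X, H X ^ 2 * ‖Φ.ψ X‖ ^ 2 ≤ ∫ X, F X := by
  have hφ : ContDiff ℝ 1 fun X : Config n => (H X : ℂ) * Φ.ψ X :=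
    (Complex.ofRealCLM.contDiff.comp hH).mul Φ.contDiff
  have h0 : ∀ Y, Y ∉ boxN n L → (fun X : Config n => (H X : ℂ) * Φ.ψ X) Y = 0 := fun Y hY => by
    simp [Φ.eq_zero Y hY]
  have h := DirichletFloor.groundStateEnergy_mul_lintegral_le hv hφ h0
  have h' : groundStateEnergy v n L * ENNReal.ofReal (∫ X, H X ^ 2 * ‖Φ.ψ X‖ ^ 2) ≤
      ENNReal.ofReal (∫ X, F X) := by
    have h1 := FirstVariation.lintegral_normSq_real_mul_eq Φ hH.continuous hC
    have h2 := FirstVariation.lintegral_density_real_mul_eq Φ hv hE hH hq hF hFeq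
    calc groundStateEnergy v n L * ENNReal.ofReal (∫ X, H X ^ 2 * ‖Φ.ψ X‖ ^ 2)
        = groundStateEnergy v n L * ∫⁻ X, ((‖(H X : ℂ) * Φ.ψ X‖₊ : ℝ≥0∞)) ^ 2 := by rw [h1]
      _ ≤ _ := h
      _ = _ := h2
  have h3 := ENNReal.toReal_mono ENNReal.ofReal_ne_top h'
  rwa [ENNReal.toReal_mul,
    ENNReal.toReal_ofReal (integral_nonneg fun X => mul_nonneg (sq_nonneg _) (sq_nonneg _)),
    ENNReal.toReal_ofReal (FirstVariation.integral_density_nonneg Φ hv hE hH hq hFeq)] at h3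

/-- **First variation of the Rayleigh quotient at a near-minimiser** (real `C¹` multiplier `G`,
`|G| ≤ 1`, `∑(∂G)² ≤ D²`; `energy Φ ≤ E₀ + δ`):
`|∫ G e_Φ + ∫ ∇G·Re(Φ̄∇Φ) − E ∫ G|Φ|²| ≤ √δ (3E + 2D² + δ + 1) + δ`. [folklore] -/
theorem abs_firstVariation_le (hv : Measurable v) (Φ : TrialState n L) (G : Config n → ℝ) (D : ℝ)
    (hG : ContDiff ℝ 1 G) (hG1 : ∀ X, |G X| ≤ 1)
    (hD : ∀ X, ∑ i : Fin n, ∑ k : Fin 3,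
      (fderiv ℝ G X (Pi.single i (EuclideanSpace.single k (1 : ℝ)))) ^ 2 ≤ D ^ 2)
    (hEfin : energy v Φ ≠ ⊤) {δ : ℝ} (hδ : 0 < δ)
    (hΦ : energy v Φ ≤ groundStateEnergy v n L + ENNReal.ofReal δ) :
    |(∫ X, G X * (kineticDensity Φ.ψ X + interaction v X * (‖Φ.ψ X‖₊ : ℝ≥0∞) ^ 2).toReal) +
        (∫ X, ∑ i : Fin n, ∑ k : Fin 3,
          fderiv ℝ G X (Pi.single i (EuclideanSpace.single k (1 : ℝ))) *
            RCLike.re (starRingEnd ℂ (Φ.ψ X) *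
              fderiv ℝ Φ.ψ X (Pi.single i (EuclideanSpace.single k (1 : ℝ))))) -
        (energy v Φ).toReal * ∫ X, G X * ‖Φ.ψ X‖ ^ 2|
      ≤ Real.sqrt δ * (3 * (energy v Φ).toReal + 2 * D ^ 2 + δ + 1) + δ := by
  -- real scalars
  have hE0le : groundStateEnergy v n L ≤ energy v Φ := iInf_le _ Φ
  have hE0 : groundStateEnergy v n L ≠ ⊤ := ne_top_of_le_ne_top hEfin hE0le
  set e := (groundStateEnergy v n L).toReal with he
  set E := (energy v Φ).toReal with hEdef
  have he0 : 0 ≤ e := ENNReal.toReal_nonneg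
  have hEe : e ≤ E := ENNReal.toReal_mono hEfin hE0le
  have hE0' : 0 ≤ E := ENNReal.toReal_nonneg
  have hEed : E ≤ e + δ := by
    have h := ENNReal.toReal_mono (ENNReal.add_ne_top.2 ⟨hE0, ENNReal.ofReal_ne_top⟩) hΦ
    rwa [ENNReal.toReal_add hE0 ENNReal.ofReal_ne_top, ENNReal.toReal_ofReal hδ.le] at h
  set s := Real.sqrt δ with hs
  have hs0 : 0 < s := Real.sqrt_pos.2 hδ
  have hs2 : s ^ 2 = δ := Real.sq_sqrt hδ.le
  -- densities `K = |∇ψ|²`, `u = V|ψ|²`, `g = |∇G|²`, `c = Σ ∂G⟨ψ, ∂ψ⟩`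
  set K : Config n → ℝ := fun X => (kineticDensity Φ.ψ X).toReal with hK
  set u : Config n → ℝ := fun X => (interaction v X * ((‖Φ.ψ X‖₊ : ℝ≥0∞)) ^ 2).toReal with hu
  set g : Config n → ℝ := fun X => ∑ i : Fin n, ∑ k : Fin 3,
    (fderiv ℝ G X (Pi.single i (EuclideanSpace.single k (1 : ℝ)))) ^ 2 with hg
  set c : Config n → ℝ := fun X => ∑ i : Fin n, ∑ k : Fin 3,
    fderiv ℝ G X (Pi.single i (EuclideanSpace.single k (1 : ℝ))) *
      inner ℝ (Φ.ψ X) (fderiv ℝ Φ.ψ X (Pi.single i (EuclideanSpace.single k (1 : ℝ)))) with hc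
  have hGd : Differentiable ℝ G := hG.differentiable one_ne_zero
  have hGc : Continuous G := hG.continuous
  have hGsq : ∀ X, G X ^ 2 ≤ 1 := fun X => by
    have h := abs_le.1 (hG1 X)
    nlinarith [h.1, h.2]
  have hGsq' : ∀ X, |G X ^ 2| ≤ 1 := fun X => by rw [abs_of_nonneg (sq_nonneg _)]; exact hGsq X
  have hg0 : ∀ X, 0 ≤ g X := fun X =>
    Finset.sum_nonneg fun i _ => Finset.sum_nonneg fun k _ => sq_nonneg _
  have hgb : ∀ X, |g X| ≤ D ^ 2 := fun X => by rw [abs_of_nonneg (hg0 X)]; exact hD X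
  have hgc : Continuous g := FirstVariation.continuous_gradSq hG
  have hK0 : ∀ X, 0 ≤ K X := fun X => ENNReal.toReal_nonneg
  have hu0 : ∀ X, 0 ≤ u X := fun X => ENNReal.toReal_nonneg
  have hcb : ∀ X, |c X| ≤ (g X * ‖Φ.ψ X‖ ^ 2 + K X) / 2 := fun X => FVCalc.abs_cross_le G Φ.ψ X
  -- integrability
  have iρ : Integrable fun X => ‖Φ.ψ X‖ ^ 2 := FirstVariation.integrable_normSq Φ
  have iK : Integrable K := FirstVariation.integrable_toReal_kineticDensity Φ hEfin
  have iu : Integrable u := FirstVariation.integrable_toReal_interaction_normSq Φ hv hEfin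
  have iKu : Integrable fun X => K X + u X := iK.add iu
  have ic : Integrable c := integrable_cross_of_sum_sq_le hG hD Φ hEfin
  have igρ : Integrable fun X => g X * ‖Φ.ψ X‖ ^ 2 := FirstVariation.integrable_bdd_mul iρ hgc hgb
  have iGKu : Integrable fun X => G X * (K X + u X) := FirstVariation.integrable_bdd_mul iKu hGc hG1
  have iG2Ku : Integrable fun X => G X ^ 2 * (K X + u X) :=
    FirstVariation.integrable_bdd_mul iKu (hGc.pow 2) hGsq'
  have iGc : Integrable fun X => G X * c X := FirstVariation.integrable_bdd_mul ic hGc hG1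
  have iGρ : Integrable fun X => G X * ‖Φ.ψ X‖ ^ 2 := FirstVariation.integrable_bdd_mul iρ hGc hG1
  have iG2ρ : Integrable fun X => G X ^ 2 * ‖Φ.ψ X‖ ^ 2 :=
    FirstVariation.integrable_bdd_mul iρ (hGc.pow 2) hGsq'
  -- the basic integrals
  have Iρ : ∫ X, ‖Φ.ψ X‖ ^ 2 = 1 := FirstVariation.integral_normSq Φ
  have IKu : ∫ X, (K X + u X) = E := FirstVariation.integral_energyDensity Φ hv hEfin
  -- the target integrals
  set a₁ := ∫ X, G X * (K X + u X) with ha₁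
  set a₂ := ∫ X, c X with ha₂
  set b₁ := ∫ X, G X * ‖Φ.ψ X‖ ^ 2 with hb₁
  set B₂ := ∫ X, G X ^ 2 * ‖Φ.ψ X‖ ^ 2 with hB₂
  -- the coefficient densities of the energy of `(1 + tG)ψ`
  set f₀ : Config n → ℝ := fun X => K X + u X with hf₀
  set f₁ : Config n → ℝ := fun X => 2 * (G X * (K X + u X)) + 2 * c X with hf₁
  set f₂ : Config n → ℝ := fun X => g X * ‖Φ.ψ X‖ ^ 2 + G X ^ 2 * (K X + u X) + 2 * (G X * c X)
    with hf₂
  have if0 : Integrable f₀ := iKu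
  have if1 : Integrable f₁ := (iGKu.const_mul 2).add (ic.const_mul 2)
  have if2 : Integrable f₂ := (igρ.add iG2Ku).add (iGc.const_mul 2)
  have If0 : ∫ X, f₀ X = E := IKu
  have If1 : ∫ X, f₁ X = 2 * a₁ + 2 * a₂ := by
    simp only [hf₁]
    rw [integral_add (iGKu.const_mul 2) (ic.const_mul 2), integral_const_mul, integral_const_mul]
  set A₂ := ∫ X, f₂ X with hA₂
  -- Step 1: the Dirichlet floor for `(1 + tG)ψ`, for every real `t`
  have hquad : ∀ t : ℝ, e * (1 + 2 * t * b₁ + t ^ 2 * B₂) ≤ E + t * (2 * a₁ + 2 * a₂) + t ^ 2 * A₂ ∧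
      0 ≤ 1 + 2 * t * b₁ + t ^ 2 * B₂ := by
    intro t
    have hH : ContDiff ℝ 1 fun X => 1 + t * G X := contDiff_const.add (contDiff_const.mul hG)
    have hq : ∀ X V, fderiv ℝ (fun X => 1 + t * G X) X V = t * fderiv ℝ G X V := by
      intro X V
      have h1 : HasFDerivAt (fun Y => 1 + t * G Y) (t • fderiv ℝ G X) X :=
        ((hGd X).hasFDerivAt.const_mul t).const_add (1 : ℝ)
      rw [h1.fderiv]
      rfl
    have hHb : ∀ X, |(fun X => 1 + t * G X) X| ≤ 1 + |t| := fun X => by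
      calc |1 + t * G X| ≤ |(1 : ℝ)| + |t * G X| := abs_add_le _ _
        _ ≤ 1 + |t| := by
          rw [abs_one, abs_mul]
          nlinarith [abs_nonneg t, hG1 X, abs_nonneg (G X)]
    have hmass : ∫ X, (1 + t * G X) ^ 2 * ‖Φ.ψ X‖ ^ 2 = 1 + 2 * t * b₁ + t ^ 2 * B₂ := by
      have hexp : (fun X => (1 + t * G X) ^ 2 * ‖Φ.ψ X‖ ^ 2) = fun X =>
          ‖Φ.ψ X‖ ^ 2 + 2 * t * (G X * ‖Φ.ψ X‖ ^ 2) + t ^ 2 * (G X ^ 2 * ‖Φ.ψ X‖ ^ 2) := by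
        funext X; ring
      have i1 : Integrable fun X => 2 * t * (G X * ‖Φ.ψ X‖ ^ 2) := iGρ.const_mul _
      have i2 : Integrable fun X => t ^ 2 * (G X ^ 2 * ‖Φ.ψ X‖ ^ 2) := iG2ρ.const_mul _
      have i01 : Integrable fun X => ‖Φ.ψ X‖ ^ 2 + 2 * t * (G X * ‖Φ.ψ X‖ ^ 2) := iρ.add i1
      rw [hexp, integral_add i01 i2, integral_add iρ i1, integral_const_mul, integral_const_mul,
        Iρ]
    have hMt : 0 ≤ 1 + 2 * t * b₁ + t ^ 2 * B₂ := by
      rw [← hmass]; exact integral_nonneg fun X => mul_nonneg (sq_nonneg _) (sq_nonneg _)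
    have if1t : Integrable fun X => t * f₁ X := if1.const_mul t
    have if2t : Integrable fun X => t ^ 2 * f₂ X := if2.const_mul _
    have i01 : Integrable fun X => f₀ X + t * f₁ X := if0.add if1t
    have iF : Integrable fun X => f₀ X + t * f₁ X + t ^ 2 * f₂ X := i01.add if2t
    have hle := groundStateEnergy_toReal_mul_le_of_contDiff Φ hv hEfin hH hq hHb iF (fun X => by
      simp only [hf₀, hf₁, hf₂, hK, hu, hg, hc]; ring)
    rw [hmass, integral_add i01 if2t, integral_add if0 if1t, integral_const_mul,
      integral_const_mul, If0, If1] at hle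
    exact ⟨hle, hMt⟩
  -- Step 2: bounds on the coefficients
  have hb₁ : |b₁| ≤ 1 := by
    calc |b₁| ≤ ∫ X, |G X * ‖Φ.ψ X‖ ^ 2| := abs_integral_le_integral_abs
      _ ≤ ∫ X, ‖Φ.ψ X‖ ^ 2 := integral_mono iGρ.abs iρ fun X => by
          show |G X * ‖Φ.ψ X‖ ^ 2| ≤ ‖Φ.ψ X‖ ^ 2
          rw [abs_mul, abs_of_nonneg (sq_nonneg ‖Φ.ψ X‖)]
          exact mul_le_of_le_one_left (sq_nonneg _) (hG1 X)
      _ = 1 := Iρ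
  have hB₂0 : 0 ≤ B₂ := integral_nonneg fun X => mul_nonneg (sq_nonneg _) (sq_nonneg _)
  have hB₂1 : B₂ ≤ 1 := by
    calc B₂ ≤ ∫ X, ‖Φ.ψ X‖ ^ 2 :=
          integral_mono iG2ρ iρ fun X => mul_le_of_le_one_left (sq_nonneg _) (hGsq X)
      _ = 1 := Iρ
  have hA₂ : A₂ ≤ 2 * E + 2 * D ^ 2 := by
    have hpt : ∀ X, f₂ X ≤ 2 * (D ^ 2 * ‖Φ.ψ X‖ ^ 2) + 2 * (K X + u X) := by
      intro X
      simp only [hf₂]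
      have h1 : g X * ‖Φ.ψ X‖ ^ 2 ≤ D ^ 2 * ‖Φ.ψ X‖ ^ 2 :=
        mul_le_mul_of_nonneg_right (hD X) (sq_nonneg _)
      have h2 : G X ^ 2 * (K X + u X) ≤ K X + u X :=
        mul_le_of_le_one_left (add_nonneg (hK0 X) (hu0 X)) (hGsq X)
      have h3 : G X * c X ≤ |c X| := by
        calc G X * c X ≤ |G X * c X| := le_abs_self _
          _ = |G X| * |c X| := abs_mul _ _
          _ ≤ 1 * |c X| := mul_le_mul_of_nonneg_right (hG1 X) (abs_nonneg _)
          _ = |c X| := one_mul _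
      have h4 := hcb X
      have h5 := hu0 X
      have h6 := hK0 X
      have h7 : 0 ≤ g X * ‖Φ.ψ X‖ ^ 2 := mul_nonneg (hg0 X) (sq_nonneg _)
      linarith
    have ibd : Integrable fun X => 2 * (D ^ 2 * ‖Φ.ψ X‖ ^ 2) + 2 * (K X + u X) :=
      ((iρ.const_mul _).const_mul 2).add (iKu.const_mul 2)
    calc A₂ ≤ ∫ X, (2 * (D ^ 2 * ‖Φ.ψ X‖ ^ 2) + 2 * (K X + u X)) := integral_mono if2 ibd hpt
      _ = 2 * D ^ 2 + 2 * E := by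
          rw [integral_add ((iρ.const_mul _).const_mul 2) (iKu.const_mul 2), integral_const_mul,
            integral_const_mul, integral_const_mul, Iρ, IKu, mul_one]
      _ = 2 * E + 2 * D ^ 2 := by ring
  -- Step 3: identify the target integrals
  have hx : (∫ X, G X * (kineticDensity Φ.ψ X +
      interaction v X * (‖Φ.ψ X‖₊ : ℝ≥0∞) ^ 2).toReal) = a₁ := by
    simp only [ha₁]
    refine integral_congr_ae ?_
    filter_upwards [FirstVariation.ae_interaction_normSq_ne_top Φ hv hEfin] with X hX
    simp only [hK, hu]
    rw [ENNReal.toReal_add (FVCalc.kineticDensity_ne_top _ _) hX]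
  have hy : (∫ X, ∑ i : Fin n, ∑ k : Fin 3,
      fderiv ℝ G X (Pi.single i (EuclideanSpace.single k (1 : ℝ))) *
        RCLike.re (starRingEnd ℂ (Φ.ψ X) *
          fderiv ℝ Φ.ψ X (Pi.single i (EuclideanSpace.single k (1 : ℝ))))) = a₂ := by
    simp only [ha₂, hc]
    refine integral_congr_ae (ae_of_all _ fun X => ?_)
    refine Finset.sum_congr rfl fun i _ => Finset.sum_congr rfl fun k _ => ?_
    rw [inner_eq_re_conj_mul]
  rw [hx, hy]
  -- Step 4: compare at `t = ± √δ`
  obtain ⟨hq1, hM1⟩ := hquad s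
  obtain ⟨hq2, hM2⟩ := hquad (-s)
  rw [hs2] at hq1 hM1
  rw [neg_sq, hs2] at hq2 hM2
  have h1 : 0 ≤ (e + δ - E) * (1 + 2 * s * b₁ + δ * B₂) := mul_nonneg (by linarith) hM1
  have h1' : 0 ≤ (e + δ - E) * (1 + 2 * (-s) * b₁ + δ * B₂) := mul_nonneg (by linarith) hM2
  have h2 : 0 ≤ δ * (E * B₂) := mul_nonneg hδ.le (mul_nonneg hE0' hB₂0)
  have h3 : δ * A₂ ≤ δ * (2 * E + 2 * D ^ 2) := mul_le_mul_of_nonneg_left hA₂ hδ.le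
  have hb₁' := abs_le.1 hb₁
  have h4 : δ * s * b₁ ≤ δ * s := mul_le_of_le_one_right (by positivity) hb₁'.2
  have h4' : -(δ * s) ≤ δ * s * b₁ := by
    have := mul_le_mul_of_nonneg_left hb₁'.1 (by positivity : (0 : ℝ) ≤ δ * s)
    linarith
  have h5 : δ * δ * B₂ ≤ δ * δ := mul_le_of_le_one_right (by positivity) hB₂1
  have hplus : 2 * s * (E * b₁ - a₁ - a₂) ≤
      2 * δ * E + 2 * δ * D ^ 2 + δ + 2 * (δ * s) + δ * δ := by
    linarith [hq1, h1, h2, h3, h4, h5]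
  have hminus : 2 * s * (a₁ + a₂ - E * b₁) ≤
      2 * δ * E + 2 * δ * D ^ 2 + δ + 2 * (δ * s) + δ * δ := by
    linarith [hq2, h1', h2, h3, h4', h5]
  have hT : 2 * δ * E + 2 * δ * D ^ 2 + δ + 2 * (δ * s) + δ * δ ≤
      2 * s * (s * (3 * E + 2 * D ^ 2 + δ + 1) + δ) := by
    have hss : s * s = δ := by rw [← sq]; exact hs2
    have hexp : 2 * s * (s * (3 * E + 2 * D ^ 2 + δ + 1) + δ) =
        2 * (s * s) * (3 * E + 2 * D ^ 2 + δ + 1) + 2 * (δ * s) := by ring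
    rw [hexp, hss]
    linarith [mul_nonneg hδ.le hE0', mul_nonneg hδ.le (sq_nonneg D), mul_pos hδ hδ]
  have hup : a₁ + a₂ - E * b₁ ≤ s * (3 * E + 2 * D ^ 2 + δ + 1) + δ :=
    le_of_mul_le_mul_left (hminus.trans hT) (by positivity)
  have hlo : -(a₁ + a₂ - E * b₁) ≤ s * (3 * E + 2 * D ^ 2 + δ + 1) + δ := by
    refine le_of_mul_le_mul_left (le_trans ?_ hT) (by positivity : (0 : ℝ) < 2 * s)
    linarith
  exact abs_le.2 ⟨by linarith, hup⟩

end FirstVariationRQ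

/-- **`stub_firstVariation` — first variation of the Rayleigh quotient at a near-minimiser under a
real `C¹` multiplier.** For a measurable pair potential `v`, an admissible `Φ` in the box `L` with
finite energy `E = ⟨Φ,HΦ⟩ ≤ E₀(N,L) + δ` (`δ > 0`) and a `C¹` function `G : (ℝ³)^N → ℝ` with
`|G| ≤ 1` and `∑_{i,k}|∂_{i,k}G|² ≤ D²`,
`|∫ G e_Φ + ∫ ∑_{i,k} ∂_{i,k}G · Re(Φ̄ ∂_{i,k}Φ) − E ∫ G|Φ|²| ≤ √δ (3E + 2D² + δ + 1) + δ`
(`e_Φ = |∇Φ|² + ∑v|Φ|²`). Proof: the Dirichlet bosonic floor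
(`DirichletFloor.groundStateEnergy_mul_lintegral_le`, no symmetry needed) for the `C¹` functions
`(1 + tG)Φ` vanishing off the box, whose energy and mass are quadratic polynomials in `t`, compared
at `t = ±√δ` (`FirstVariationRQ.abs_firstVariation_le`). [folklore: first variation / virial] -/
theorem stub_firstVariation :
    ∀ (v : ℝ → ℝ≥0∞), Measurable v → ∀ {N : ℕ} {L : ℝ} (Φ : TrialState N L) (G : Config N → ℝ) (D : ℝ),
      ContDiff ℝ 1 G → (∀ X, |G X| ≤ 1) →
      (∀ X, ∑ i : Fin N, ∑ k : Fin 3,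
          (fderiv ℝ G X (Pi.single i (EuclideanSpace.single k (1 : ℝ)))) ^ 2 ≤ D ^ 2) →
      0 ≤ D → energy v Φ ≠ ⊤ → ∀ δ : ℝ, 0 < δ →
      energy v Φ ≤ groundStateEnergy v N L + ENNReal.ofReal δ →
      |(∫ X, G X * (kineticDensity Φ.ψ X + interaction v X * (‖Φ.ψ X‖₊ : ℝ≥0∞) ^ 2).toReal) +
          (∫ X, ∑ i : Fin N, ∑ k : Fin 3,
            fderiv ℝ G X (Pi.single i (EuclideanSpace.single k (1 : ℝ))) *
              RCLike.re (starRingEnd ℂ (Φ.ψ X) *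
                fderiv ℝ Φ.ψ X (Pi.single i (EuclideanSpace.single k (1 : ℝ))))) -
          (energy v Φ).toReal * ∫ X, G X * ‖Φ.ψ X‖ ^ 2|
        ≤ Real.sqrt δ * (3 * (energy v Φ).toReal + 2 * D ^ 2 + δ + 1) + δ :=
  fun _v hv _N _L Φ G D hG hG1 hD _hD0 hE _δ hδ hΦ =>
    FirstVariationRQ.abs_firstVariation_le hv Φ G D hG hG1 hD hE hδ hΦ

end Summit.AtomisticToContinuum.BoseEinsteinCondensation.Theorems.RigidMomentumBound

end
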